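import Literature.Analysis.Complex.HarmonicMaxPrinciple
import Mathlib.Analysis.InnerProductSpace.Harmonic.Constructions
import HarnessLib

/-!
# The maximum principle for bounded harmonic functions with finitely many exceptional boundary points

Topic `Literature/Analysis/Complex` (harmonic functions; companion of `HarmonicMaxPrinciple.lean`).
The classical extension of the maximum principle (Lindelöf): a harmonic function which is
**bounded above** on a bounded domain and has `lim sup ≤ M` at every boundary point except
finitely many is `≤ M` — the exceptional points are absorbed by the logarithmic barriers
`ε log(R/|z - p|)`, which are positive harmonic and tend to `+∞` at `p`, after which `ε → 0`.
This is the form of the maximum principle by which boundary values on the open arcs of a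
partition of the circle determine a bounded harmonic function (the junction points of the arcs
being exceptional), as in the identification of scaling limits with conformal maps onto polygons
— e.g. G. F. Lawler, O. Schramm, W. Werner, Ann. Probab. 32 (2004), proof of Prop. 4.1 (§5.4: "It
now easily follows (e.g., from the maximum principle) that `h + ik` is the (unique) conformal map
taking `𝕌` to the rectangle"), and S. Smirnov's identification of the percolation crossing
observable.

* `harmonicOnNhd_sum_log_norm_sub` — `z ↦ ∑_{p ∈ E} log ‖z - p‖` is harmonic off `E`;
* **`harmonic_le_of_frontier_except`** — `U` open, preconnected, bounded; `u` harmonic on `U`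
  with `u ≤ B`; `E` a finite set of points outside `U`; if `lim sup_{z → ζ, z ∈ U} u ≤ M` at every
  `ζ ∈ ∂U ∖ E`, then `u ≤ M` on `U`.

Everything is proved (from the lim-sup maximum principle `harmonic_le_of_frontier_of_cocompact`
of the companion file and Mathlib's `AnalyticAt.harmonicAt_log_norm`).

## References

* J. B. Conway, *Functions of One Complex Variable* (1978), Ch. X §1; M. Tsuji, *Potential Theory
  in Modern Function Theory* (1959), Thm. III.28 (Lindelöf's maximum principle). [Conway1978]
* G. F. Lawler, O. Schramm, W. Werner, Ann. Probab. 32 (2004), §5.4. [LawlerSchrammWerner2004]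
-/

noncomputable section

open Set Filter Metric Topology Complex InnerProductSpace

namespace Literature.Analysis.Complex

/-- `z ↦ log ‖z - p‖` is harmonic away from `p`. [folklore] -/
theorem harmonicAt_log_norm_sub {p x : ℂ} (hx : x ≠ p) :
    HarmonicAt (fun z : ℂ ↦ Real.log ‖z - p‖) x :=
  (analyticAt_id.sub analyticAt_const).harmonicAt_log_norm (sub_ne_zero.2 hx)

/-- A finite sum of logarithmic poles `z ↦ ∑_{p ∈ E} log ‖z - p‖` is harmonic on any set
missing the poles. [folklore] -/
theorem harmonicOnNhd_sum_log_norm_sub (E : Finset ℂ) {U : Set ℂ} (hE : ∀ p ∈ E, p ∉ U) :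
    HarmonicOnNhd (fun z : ℂ ↦ ∑ p ∈ E, Real.log ‖z - p‖) U := by
  classical
  induction E using Finset.induction_on with
  | empty =>
    intro x _
    simpa only [Finset.sum_empty] using harmonicAt_const (0 : ℝ)
  | insert a s ha ih =>
    intro x hx
    have hxa : x ≠ a := fun h ↦ hE a (Finset.mem_insert_self a s) (h ▸ hx)
    have h1 : HarmonicAt (fun z : ℂ ↦ Real.log ‖z - a‖) x := harmonicAt_log_norm_sub hxa
    have h2 : HarmonicAt (fun z : ℂ ↦ ∑ p ∈ s, Real.log ‖z - p‖) x :=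
      ih (fun p hp ↦ hE p (Finset.mem_insert_of_mem hp)) x hx
    have h3 := h1.add h2
    have heq : (fun z : ℂ ↦ ∑ p ∈ insert a s, Real.log ‖z - p‖) =
        (fun z : ℂ ↦ Real.log ‖z - a‖) + fun z : ℂ ↦ ∑ p ∈ s, Real.log ‖z - p‖ := by
      funext z
      simp [Finset.sum_insert ha]
    rw [heq]
    exact h3

/-- For a bounded set, the filter `cocompact ℂ ⊓ 𝓟 U` is trivial. [folklore] -/
theorem cocompact_inf_principal_eq_bot_of_isBounded {U : Set ℂ} (hU : Bornology.IsBounded U) :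
    cocompact ℂ ⊓ 𝓟 U = ⊥ := by
  rw [inf_principal_eq_bot]
  obtain ⟨R, hR⟩ := hU.subset_closedBall 0
  exact Filter.mem_of_superset ((isCompact_closedBall (0 : ℂ) R).compl_mem_cocompact)
    (compl_subset_compl.2 hR)

/-- **Maximum principle with finitely many exceptional boundary points** (Lindelöf). Let `U ⊆ ℂ`
be open, preconnected and bounded, `u` harmonic on `U` and bounded above there (`u ≤ B`), and
`E` a finite set of points not in `U`. If `lim sup_{z → ζ, z ∈ U} u(z) ≤ M` at every frontier
point `ζ ∉ E`, then `u ≤ M` on `U`. Proof: for `ε > 0` the function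
`u + ε ∑_{p ∈ E} (log ‖z - p‖ - log R_p)` (`R_p` an upper bound for `‖z - p‖` on `U`) is harmonic,
`≤ u`, and tends to `-∞` at the points of `E`, so the lim-sup maximum principle
(`harmonic_le_of_frontier_of_cocompact`) bounds it by `M`; then let `ε → 0`.
[cite: Conway1978, Ch. X §1 (Maximum Principle)] -/
theorem harmonic_le_of_frontier_except {U : Set ℂ} (hUo : IsOpen U) (hUc : IsPreconnected U)
    (hUb : Bornology.IsBounded U) {u : ℂ → ℝ} (hu : HarmonicOnNhd u U) {B M : ℝ}
    (hB : ∀ z ∈ U, u z ≤ B) (E : Finset ℂ) (hE : ∀ p ∈ E, p ∉ U)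
    (hbdry : ∀ ζ ∈ frontier U, ζ ∉ E → ∀ ε : ℝ, 0 < ε → ∀ᶠ z in 𝓝[U] ζ, u z ≤ M + ε) :
    ∀ z ∈ U, u z ≤ M := by
  classical
  -- a common bound `R` for `‖z - p‖`, `z ∈ U`, `p ∈ E`
  obtain ⟨R₀, hR₀⟩ := hUb.subset_closedBall 0
  set R : ℝ := |R₀| + (∑ p ∈ E, ‖p‖) + 1 with hRdef
  have hR1 : 1 ≤ R := by
    have : 0 ≤ ∑ p ∈ E, ‖p‖ := Finset.sum_nonneg fun p _ ↦ norm_nonneg p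
    rw [hRdef]; linarith [abs_nonneg R₀]
  have hR0 : 0 < R := by linarith
  have hzp : ∀ z ∈ U, ∀ p ∈ E, ‖z - p‖ < R := fun z hz p hp ↦ by
    have h1 : ‖z‖ ≤ |R₀| := (mem_closedBall_zero_iff.1 (hR₀ hz)).trans (le_abs_self _)
    have h2 : ‖p‖ ≤ ∑ q ∈ E, ‖q‖ :=
      Finset.single_le_sum (f := fun q ↦ ‖q‖) (fun q _ ↦ norm_nonneg q) hp
    calc ‖z - p‖ ≤ ‖z‖ + ‖p‖ := norm_sub_le _ _
      _ < R := by rw [hRdef]; linarith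
  -- the logarithmic barrier `b z = ∑ (log R - log ‖z - p‖) ≥ 0`
  set L : ℂ → ℝ := fun z ↦ ∑ p ∈ E, Real.log ‖z - p‖ with hL
  set C : ℝ := ∑ p ∈ E, Real.log R with hC
  have hL_harm : HarmonicOnNhd L U := harmonicOnNhd_sum_log_norm_sub E hE
  have hC0 : 0 ≤ C := Finset.sum_nonneg fun p _ ↦ Real.log_nonneg hR1
  have hLC : ∀ z ∈ U, L z ≤ C := fun z hz ↦
    Finset.sum_le_sum fun p hp ↦ Real.log_le_log (norm_pos_iff.2 (sub_ne_zero.2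
      (fun h ↦ hE p hp (h ▸ hz)))) (hzp z hz p hp).le
  -- the claim for each `ε > 0`
  have key : ∀ ε : ℝ, 0 < ε → ∀ z ∈ U, u z + ε * L z ≤ M + ε * C := by
    intro ε hε
    have hv : HarmonicOnNhd (fun z ↦ u z + ε * L z) U := by
      have := hu.add (hL_harm.const_smul (c := ε))
      simpa [Pi.add_def, Pi.smul_def, smul_eq_mul] using this
    refine harmonic_le_of_frontier_of_cocompact hUo hUc hv (M := M + ε * C) ?_ ?_
    · intro ζ hζ ε' hε'
      by_cases hζE : ζ ∈ E
      · -- near an exceptional point the barrier wins: `u + ε L → -∞`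
        -- radius at which `ε log ‖z - ζ‖` is below `M - B - ε C + ε log R · (card - 1)`…
        -- we simply make `ε * log ‖z - ζ‖ ≤ M - B - ε * (C - Real.log R) ` hold.
        set T : ℝ := (M - B) / ε - (C - Real.log R) with hT
        set δ : ℝ := min 1 (Real.exp T) with hδ
        have hδ0 : 0 < δ := lt_min one_pos (Real.exp_pos T)
        have hball : ∀ z ∈ U, ‖z - ζ‖ < δ → u z + ε * L z ≤ M + ε * C := by
          intro z hz hzδ
          have hzζ : z ≠ ζ := fun h ↦ hE ζ hζE (h ▸ hz)
          have hn0 : 0 < ‖z - ζ‖ := norm_pos_iff.2 (sub_ne_zero.2 hzζ)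
          -- `log ‖z - ζ‖ ≤ T`
          have hlogT : Real.log ‖z - ζ‖ ≤ T := by
            have : ‖z - ζ‖ < Real.exp T := hzδ.trans_le (min_le_right _ _)
            exact (Real.log_le_log hn0 this.le).trans (by rw [Real.log_exp])
          -- `L z ≤ log ‖z - ζ‖ + (C - log R)`
          have hLz : L z ≤ Real.log ‖z - ζ‖ + (C - Real.log R) := by
            have hsplit : L z = Real.log ‖z - ζ‖ + ∑ p ∈ E.erase ζ, Real.log ‖z - p‖ := by
              rw [hL]; exact (Finset.add_sum_erase E (fun p ↦ Real.log ‖z - p‖) hζE).symm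
            have hCsplit : C = Real.log R + ∑ p ∈ E.erase ζ, Real.log R := by
              rw [hC]; exact (Finset.add_sum_erase E (fun _ ↦ Real.log R) hζE).symm
            have hrest : ∑ p ∈ E.erase ζ, Real.log ‖z - p‖ ≤ ∑ p ∈ E.erase ζ, Real.log R :=
              Finset.sum_le_sum fun p hp ↦ Real.log_le_log (norm_pos_iff.2 (sub_ne_zero.2
                (fun h ↦ hE p (Finset.mem_of_mem_erase hp) (h ▸ hz))))
                (hzp z hz p (Finset.mem_of_mem_erase hp)).le
            rw [hsplit, hCsplit]; linarith
          have hLz' : L z ≤ T + (C - Real.log R) := by linarith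
          have h1 : ε * L z ≤ ε * (T + (C - Real.log R)) := mul_le_mul_of_nonneg_left hLz' hε.le
          have h2 : ε * T = M - B - ε * (C - Real.log R) := by
            rw [hT]; field_simp
          have h3 : ε * (T + (C - Real.log R)) = M - B := by rw [mul_add, h2]; ring
          linarith [hB z hz, mul_nonneg hε.le hC0]
        have hmem : U ∩ ball ζ δ ∈ 𝓝[U] ζ := inter_mem_nhdsWithin U (ball_mem_nhds ζ hδ0)
        filter_upwards [hmem] with z hz
        have := hball z hz.1 (by rw [← dist_eq_norm]; exact mem_ball.1 hz.2)
        linarith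
      · have h := hbdry ζ hζ hζE ε' hε'
        filter_upwards [h, self_mem_nhdsWithin] with z hz hzU
        have := mul_le_mul_of_nonneg_left (hLC z hzU) hε.le
        linarith
    · intro ε' hε'
      rw [cocompact_inf_principal_eq_bot_of_isBounded hUb]
      exact eventually_bot
  -- let `ε → 0`
  intro z hz
  have hb : 0 ≤ C - L z := sub_nonneg.2 (hLC z hz)
  refine le_of_forall_pos_lt_add fun η hη ↦ ?_
  have hε : 0 < η / (C - L z + 1) := div_pos hη (by linarith)
  have h := key _ hε z hz
  have h2 : η / (C - L z + 1) * (C - L z) < η := by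
    rw [div_mul_eq_mul_div, div_lt_iff₀ (by linarith)]
    nlinarith
  nlinarith [h, h2]

end Literature.Analysis.Complex
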